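import Literature.NumberTheory.Automorphic.UnitaryGroupStableOrbitalIntegral
import Literature.NumberTheory.Automorphic.UnitaryGroupPureTensorIntegral
import Literature.MeasureTheory.Group.InvariantQuotientOrbitalProd
import HarnessLib

/-!
# The `∞ × f` split of the adelic orbital integral on `U(H)(𝔸_{L⁺})`:
# `Φ(γ, F₁(g_∞)·F₂(g_f)) = κ_γ · O_{γ_∞}(F₁) · O_{γ_f}(F₂)`, and for pure tensors `Φ(γ, ⊗ f_v) = κ_γ · O_{γ_∞}(f_∞) · O_{γ_f}(Λ_T)`
(Gelbart, *Automorphic forms on adele groups* (1975), p. 155 (10.19): orbital integrals of factorizable functions factor; Borel–Jacquet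
(1979), §4.1: `G(𝔸) = G_∞ × G(𝔸_f)`; Rogawski (1990), §5.4 p. 71, §14.2 p. 233)

Topic `NumberTheory/Automorphic`; namespace `Literature.NumberTheory.Automorphic.UnitaryGroup`; THEOREMS ONLY (no def, no instance, no
named fact, no `sorry`).  The ORBITAL twin of ★ B13 `UnitaryGroupPureTensorIntegral` (the `∞ ⊔ f` split of plain adelic integrals), for
the tree's ★ `adelicOrbitalIntegral L N H γ F μ = orbitalIntegral (toAdelic γ) F μ = ∫_{U(H)(𝔸) ⧸ U(H)(𝔸)_γ} F(y γ y⁻¹) dμ` (T1b-3; stated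
here with ★ `orbitalIntegral` at `toAdelic γ`, the `rfl`-unfolding, so that only the orbit space of `γ` needs a Borel structure) at a RATIONAL `γ`:

* `exists_adelicOrbitalIntegral_eq_smul_arch_mul_fin` — along ★ `adelicProdEquiv : U(H)(𝔸) ≃ₜ* U(H)(L ⊗ ℝ) × U(H)(𝔸_f)` the centraliser of
  `γ` is the product of the centralisers of `γ_∞ = archPart γ` and `γ_f = finPart γ`, so for non-zero invariant measures `μ`, `μ_∞`, `μ_f`
  finite on compact sets on the three orbit spaces there is ONE `κ > 0` (depending on `γ` and the measures, not on the integrand) with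
  `Φ(γ, F) = κ · O_{γ_∞}^{μ_∞}(F₁) · O_{γ_f}^{μ_f}(F₂)` for every `F` with `F(g) = F₁(g_∞) F₂(g_f)` (★ `exists_integral_descConj_eq_smul_mul`);
* **`exists_adelicOrbitalIntegral_eval_eq_smul_arch_mul_finFactor`** — for a ★ `PureTensor` `T` with integral levels off `T.S`:
  `Φ(γ, T.eval) = κ · O_{γ_∞}(T.arch) · O_{γ_f}(Λ_T)` with B13's FINITE-ADELIC FACTOR `Λ_T(b) = 1_{b_v ∈ U(H)(𝒪_v), v ∉ S} · ∏_{v ∈ S} f_v(b_v)`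
  (★ `PureTensor.eval_eq_arch_mul_finFactor`) — the input of the finite-adelic Euler factorisation (O2, p06: `O_{γ_f}(Λ_T) = ∏_v O_{γ_v}(f_v)`).
Measures are PARAMETERS (admissible: invariant, finite on compacts, non-zero; the finite-adelic and archimedean ones s-finite); inhabitants:
★ `UnitaryGroupAdelicOrbitalMeasure` (adelic, regular `γ`), ★ `LocalOrbitalMeasureRegular` (local), O2 (finite-adelic restricted product).

## References
* S. Gelbart, *Automorphic forms on adele groups*, Ann. of Math. Stud. 83 (1975), p. 155 (10.19) [Gelbart1975].
* A. Borel, H. Jacquet, *Automorphic forms and automorphic representations*, PSPM 33.1 (1979), §4.1 [BorelJacquet1979].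
* J. D. Rogawski, *Automorphic Representations of Unitary Groups in Three Variables* (1990), §5.4 p. 71, §14.2 p. 233 [Rogawski1990].
-/

noncomputable section

open MeasureTheory Measure Set Filter Topology NumberField CompactlySupported
open Literature.MeasureTheory.Group
open scoped ENNReal NNReal Pointwise

namespace Literature.NumberTheory.Automorphic

namespace UnitaryGroup

variable (L : Type) [Field L] [NumberField L] [IsCMField L] (N : ℕ) (H : Matrix (Fin N) (Fin N) L)

/-- `(g_∞, 1)·(1, g_f) ↦ g`: the inverse of ★ `adelicProdEquiv` sends `(archPart γ, finPart γ)` to `γ`. [cite: BorelJacquet1979, §4.1] -/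
theorem adelicProdEquiv_symm_archPart_finPart (g : (cmDatum L N H).Adelic) :
    (adelicProdEquiv (↥(maximalRealSubfield L)) L (IsCMField.complexConj L) N H).symm
        (archPart (↥(maximalRealSubfield L)) L (IsCMField.complexConj L) N H g,
          finPart (↥(maximalRealSubfield L)) L (IsCMField.complexConj L) N H g) = g :=
  archToAdelic_mul_finAdelicToAdelic (↥(maximalRealSubfield L)) L (IsCMField.complexConj L) N H g

section Split

variable (γ : (cmDatum L N H).Rational)
  [MeasurableSpace ((cmDatum L N H).Adelic ⧸
    Subgroup.centralizer ({(cmDatum L N H).toAdelic γ} : Set (cmDatum L N H).Adelic))]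
  [BorelSpace ((cmDatum L N H).Adelic ⧸
    Subgroup.centralizer ({(cmDatum L N H).toAdelic γ} : Set (cmDatum L N H).Adelic))]
  [MeasurableSpace (arch (↥(maximalRealSubfield L)) L (IsCMField.complexConj L) N H ⧸
    Subgroup.centralizer ({archPart (↥(maximalRealSubfield L)) L (IsCMField.complexConj L) N H ((cmDatum L N H).toAdelic γ)} :
      Set (arch (↥(maximalRealSubfield L)) L (IsCMField.complexConj L) N H)))]
  [BorelSpace (arch (↥(maximalRealSubfield L)) L (IsCMField.complexConj L) N H ⧸
    Subgroup.centralizer ({archPart (↥(maximalRealSubfield L)) L (IsCMField.complexConj L) N H ((cmDatum L N H).toAdelic γ)} :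
      Set (arch (↥(maximalRealSubfield L)) L (IsCMField.complexConj L) N H)))]
  [MeasurableSpace (finAdelic (↥(maximalRealSubfield L)) L (IsCMField.complexConj L) N H ⧸
    Subgroup.centralizer ({finPart (↥(maximalRealSubfield L)) L (IsCMField.complexConj L) N H ((cmDatum L N H).toAdelic γ)} :
      Set (finAdelic (↥(maximalRealSubfield L)) L (IsCMField.complexConj L) N H)))]
  [BorelSpace (finAdelic (↥(maximalRealSubfield L)) L (IsCMField.complexConj L) N H ⧸
    Subgroup.centralizer ({finPart (↥(maximalRealSubfield L)) L (IsCMField.complexConj L) N H ((cmDatum L N H).toAdelic γ)} :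
      Set (finAdelic (↥(maximalRealSubfield L)) L (IsCMField.complexConj L) N H)))]
  (μ : Measure ((cmDatum L N H).Adelic ⧸
    Subgroup.centralizer ({(cmDatum L N H).toAdelic γ} : Set (cmDatum L N H).Adelic)))
  [SMulInvariantMeasure (cmDatum L N H).Adelic _ μ] [IsFiniteMeasureOnCompacts μ]
  (μa : Measure (arch (↥(maximalRealSubfield L)) L (IsCMField.complexConj L) N H ⧸
    Subgroup.centralizer ({archPart (↥(maximalRealSubfield L)) L (IsCMField.complexConj L) N H ((cmDatum L N H).toAdelic γ)} :
      Set (arch (↥(maximalRealSubfield L)) L (IsCMField.complexConj L) N H))))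
  [SMulInvariantMeasure (arch (↥(maximalRealSubfield L)) L (IsCMField.complexConj L) N H) _ μa] [IsFiniteMeasureOnCompacts μa]
  [SFinite μa]
  (μf : Measure (finAdelic (↥(maximalRealSubfield L)) L (IsCMField.complexConj L) N H ⧸
    Subgroup.centralizer ({finPart (↥(maximalRealSubfield L)) L (IsCMField.complexConj L) N H ((cmDatum L N H).toAdelic γ)} :
      Set (finAdelic (↥(maximalRealSubfield L)) L (IsCMField.complexConj L) N H))))
  [SMulInvariantMeasure (finAdelic (↥(maximalRealSubfield L)) L (IsCMField.complexConj L) N H) _ μf] [IsFiniteMeasureOnCompacts μf]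
  [SFinite μf]

/-- **The `∞ × f` split of the adelic orbital integral at a rational `γ`.**  For non-zero invariant measures `μ` on
`U(H)(𝔸) ⧸ U(H)(𝔸)_γ`, `μ_∞` on `U(H)(L ⊗ ℝ) ⧸ C(γ_∞)`, `μ_f` on `U(H)(𝔸_f) ⧸ C(γ_f)` finite on compact sets (`μ_∞`, `μ_f` s-finite) there is ONE
`κ > 0` such that `Φ(γ, F) = κ · O_{γ_∞}^{μ_∞}(F₁) · O_{γ_f}^{μ_f}(F₂)` for EVERY `F, F₁, F₂` with `F(g) = F₁(g_∞) · F₂(g_f)` — the centraliser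
of `γ` in `U(H)(𝔸) ≅ U(H)(L ⊗ ℝ) × U(H)(𝔸_f)` is the product of the centralisers (★ `exists_integral_descConj_eq_smul_mul` along ★
`adelicProdEquiv`). No integrability hypotheses (Bochner conventions on both sides). [cite: Gelbart1975, p. 155 (10.19)] -/
theorem exists_adelicOrbitalIntegral_eq_smul_arch_mul_fin (hμ : μ ≠ 0) (ha : μa ≠ 0) (hf : μf ≠ 0) :
    ∃ κ : ℝ≥0, κ ≠ 0 ∧ ∀ (F : (cmDatum L N H).Adelic → ℂ) (F₁ : arch (↥(maximalRealSubfield L)) L (IsCMField.complexConj L) N H → ℂ)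
      (F₂ : finAdelic (↥(maximalRealSubfield L)) L (IsCMField.complexConj L) N H → ℂ),
      (∀ g, F g = F₁ (archPart (↥(maximalRealSubfield L)) L (IsCMField.complexConj L) N H g) *
        F₂ (finPart (↥(maximalRealSubfield L)) L (IsCMField.complexConj L) N H g)) →
      orbitalIntegral ((cmDatum L N H).toAdelic γ) F μ =
        κ • (orbitalIntegral (archPart (↥(maximalRealSubfield L)) L (IsCMField.complexConj L) N H ((cmDatum L N H).toAdelic γ)) F₁ μa *
          orbitalIntegral (finPart (↥(maximalRealSubfield L)) L (IsCMField.complexConj L) N H ((cmDatum L N H).toAdelic γ)) F₂ μf) := by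
  haveI := locallyCompactSpace_finAdelic (↥(maximalRealSubfield L)) L (IsCMField.complexConj L) N H
  haveI := secondCountableTopology_finAdelic (↥(maximalRealSubfield L)) L (IsCMField.complexConj L) N H
  haveI := t2Space_finAdelic (↥(maximalRealSubfield L)) L (IsCMField.complexConj L) N H
  -- the product decomposition as a bare group isomorphism `U(H)(L ⊗ ℝ) × U(H)(𝔸_f) ≃* U(H)(𝔸)`
  let E := adelicProdEquiv (↥(maximalRealSubfield L)) L (IsCMField.complexConj L) N H
  let e : arch (↥(maximalRealSubfield L)) L (IsCMField.complexConj L) N H ×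
      finAdelic (↥(maximalRealSubfield L)) L (IsCMField.complexConj L) N H ≃* (cmDatum L N H).Adelic := E.symm.toMulEquiv
  have he : Continuous e := E.symm.continuous
  have hes : Continuous e.symm := E.continuous
  have hγ : e (archPart (↥(maximalRealSubfield L)) L (IsCMField.complexConj L) N H ((cmDatum L N H).toAdelic γ),
      finPart (↥(maximalRealSubfield L)) L (IsCMField.complexConj L) N H ((cmDatum L N H).toAdelic γ)) = (cmDatum L N H).toAdelic γ :=
    adelicProdEquiv_symm_archPart_finPart L N H _
  obtain ⟨κ, hκ0, hκ⟩ := exists_integral_descConj_eq_smul_mul e he hes hγ (Set.isClosed_centralizer _) (Set.isClosed_centralizer _)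
    μ μa μf hμ ha hf
  refine ⟨κ, hκ0, fun F F₁ F₂ hF => ?_⟩
  have hfac : ∀ a k, F (e (a, k)) = F₁ a * F₂ k := fun a k => by
    have h := E.apply_symm_apply (a, k)
    rw [hF]
    change F₁ (E (E.symm (a, k))).1 * F₂ (E (E.symm (a, k))).2 = _
    rw [h]
  exact hκ F F₁ F₂ hfac

/-- **The `∞ × f` split of the adelic orbital integral of a PURE TENSOR** `T = f_∞ ⊗ ⊗_v f_v` with integral levels off `T.S`:
`Φ(γ, T.eval) = κ · O_{γ_∞}^{μ_∞}(f_∞) · O_{γ_f}^{μ_f}(Λ_T)` with B13's finite-adelic factor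
`Λ_T(b) = 1_{∀ v ∉ S, b_v ∈ U(H)(𝒪_v)} · ∏_{v ∈ S} f_v(b_v)` (★ `PureTensor.eval_eq_arch_mul_finFactor`), the same `κ` for all such `T`
— the entry point of the Euler factorisation of global orbital integrals [Rogawski1990 §5.4]. [cite: Gelbart1975, p. 155 (10.19)]
[cite: Rogawski1990, §5.4 p. 71] -/
theorem exists_adelicOrbitalIntegral_eval_eq_smul_arch_mul_finFactor (hμ : μ ≠ 0) (ha : μa ≠ 0) (hf : μf ≠ 0) :
    ∃ κ : ℝ≥0, κ ≠ 0 ∧ ∀ T : PureTensor L N H, (∀ v ∉ T.S, T.K v = cmLocalIntegralLevel L N H v) →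
      orbitalIntegral ((cmDatum L N H).toAdelic γ) T.eval μ =
        κ • (orbitalIntegral (archPart (↥(maximalRealSubfield L)) L (IsCMField.complexConj L) N H ((cmDatum L N H).toAdelic γ)) T.arch μa *
          orbitalIntegral (finPart (↥(maximalRealSubfield L)) L (IsCMField.complexConj L) N H ((cmDatum L N H).toAdelic γ))
            ({b : finAdelic (↥(maximalRealSubfield L)) L (IsCMField.complexConj L) N H |
                ∀ v ∉ T.S, evalPlace (↥(maximalRealSubfield L)) L (IsCMField.complexConj L) N H v b ∈
                  localInt L (IsCMField.complexConj L) N H v}.indicator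
              fun b => ∏ v ∈ T.S, T.loc v (localPiEquiv L (IsCMField.complexConj L) N H v
                (evalPlace (↥(maximalRealSubfield L)) L (IsCMField.complexConj L) N H v b))) μf) := by
  obtain ⟨κ, hκ0, hκ⟩ := exists_adelicOrbitalIntegral_eq_smul_arch_mul_fin L N H γ μ μa μf hμ ha hf
  exact ⟨κ, hκ0, fun T hK => hκ _ _ _ (PureTensor.eval_eq_arch_mul_finFactor T hK)⟩

end Split

end UnitaryGroup

end Literature.NumberTheory.Automorphic
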